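import Literature.RingTheory.MvPowerSeries.MonoidPowerSeriesGenerators
import Literature.RingTheory.MvPowerSeries.FrobeniusPowerBasis
import HarnessLib

/-!
# Completed chart maps as monomial substitutions: exact coefficient transport, injectivity, parity, and the
# blow-up chart `x_j ↦ x_j`, `x_i ↦ x_j·x_i` with its realisability criterion

W4.1 support file (crux `Steer`, stmt-ResolutionOfSingularities-16345; line `switching_dichotomy`), res-D-pv-007 AS
res-L0-w41-stub-5 — K2 PART 2 of plan-1 RULING 136a/136d («power-series infrastructure … the completed chart maps as monomial
substitutions, injectivity», tri-2 audit `gpd/audit_GPERF_DIRECT.md` §6 K2 / §2(i)), for res-D-pv-004's Lemma S kernel (K1) and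
res-L0-w41-stub-2's Lemma F♭: in res-L0-w41-idea-3's NT-DIRECT §1 (2) the chain maps of the completions `Ŝ₀ = K⟦X, Y, Z⟧ → Ŝ₁ =
K⟦x, y, z⟧ → Ŝ₂ = K⟦x′, y, z′⟧` ARE the monomial substitutions `X ↦ x, Y ↦ xy, Z_i ↦ x z_i` and `x ↦ x′y, y ↦ y, z_i ↦ z_i′y`.

Everything is phrased over the TREE map `Literature.RingTheory.MvPowerSeries.monoidPowerSeries.substGenerators g hg0 :
MvPowerSeries ι R →ₐ[R] MvPowerSeries σ R`, `X_i ↦ x^{g i}` (`MonoidPowerSeriesGenerators.lean`: `coeff_subst_monomial` in finsum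
form, `range_substGenerators = monoidPowerSeries R ⟨g⟩`), with its exponent map `expSum g d = Σ_i d_i • g_i`. Proved here (all
`theorem`s, no definitions, no Theses import):
* general `g`: `substGenerators_monomial` (`X^d ↦ x^{expSum g d}`), `coeff_substGenerators_eq_zero_of_forall_ne` (no monomial off
  `range (expSum g)`), `exists_expSum_eq_of_coeff_substGenerators_ne_zero` (support transport), `dvd_expSum_apply`
  (`p ∣ d ⇒ p ∣ expSum g d`: even ↦ even), `isSupportedOnMultiples_substGenerators`;
* INJECTIVE `expSum g` (§2(i)): **`coeff_substGenerators_expSum`** (`coeff_{expSum g d} (F(x^g)) = coeff_d F` — the expansion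
  downstairs IS the relabelled expansion upstairs), **`substGenerators_injective`**, and under the parity-reflection hypothesis
  `(∀ s, p ∣ expSum g d s) → ∀ i, p ∣ d i`: `exists_not_dvd_expSum_apply` (odd ↦ odd), `isSupportedOnMultiples_substGenerators_iff`;
* the CHART FAMILY at the persisting letter `j` with weight `M` (`g i = single i 1 + if i = j then 0 else M • single j 1`, i.e.
  `x_j ↦ x_j`, `x_i ↦ x_j^M x_i`; `M = 1` = the blow-up chart `X ↦ x, Y ↦ xy, Z ↦ xz`, general `M` = the `M`-step free substitution
  `ỹ ↦ x^M ỹ_M, z̃ ↦ x^M z̃_M` of Lemma F♭): `chartExp_ne_zero`, `expSum_chart_apply_of_ne` (`= d i`), `expSum_chart_apply_self`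
  (`= d j + M Σ_{i ≠ j} d i`), **`expSum_chart_injective`**, **`dvd_of_dvd_expSum_chart`** (parity reflection), **`mem_closure_chart_iff`**
  (REALISABILITY on exponents: `e ∈ ⟨g⟩ ⟺ M Σ_{i ≠ j} e i ≤ e j`), `coeff_substGenerators_chart_eq_zero`,
  **`mul_sum_le_add_of_X_pow_mul_eq_substGenerators`** (the law on supports: `x_j^n · f = F(x^g) ⇒ M Σ_{i ≠ j} e i ≤ e j + n` for every
  monomial `e` of `f`; NT-DIRECT (α) `b + |γ| ≤ a + d`), **`coeff_substGenerators_chart_expSum`** (exact transport).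

Elementary [folklore; cite: Kato1994, §3 for `R⟦P⟧` and `X_i ↦ x^{g_i}`]. OURS (campaign res-hironaka); nothing here is attributed to
[Hironaka2017]. -/

noncomputable section

-- `Summit.<S>.<S>.…` duplicates the summit name by design (single-problem summit).
set_option linter.dupNamespace false

open MvPowerSeries
open Literature.RingTheory.MvPowerSeries Literature.RingTheory.MvPowerSeries.monoidPowerSeries

namespace Summit.ResolutionOfSingularities.ResolutionOfSingularities.Theorems.SwitchingDichotomy.ChartMonomialSubst

universe u v w

variable {σ : Type u} {R : Type v} [CommRing R] {ι : Type w} [Finite ι] (g : ι → (σ →₀ ℕ)) (hg0 : ∀ i, g i ≠ 0)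

section General

/-- `X^d ↦ x^{expSum g d}` (with the same coefficient): the substitution on monomials. [cite: Kato1994, §3] -/
theorem substGenerators_monomial (d : ι →₀ ℕ) (r : R) :
    substGenerators (R := R) g hg0 (monomial d r) = monomial (expSum g d) r := by
  classical
  ext e
  rw [substGenerators_apply, coeff_subst_monomial g hg0, coeff_monomial, finsum_eq_single _ d]
  · rw [coeff_monomial, if_pos rfl]
    by_cases h : expSum g d = e
    · rw [if_pos h, if_pos h.symm]
    · rw [if_neg h, if_neg (fun h' => h h'.symm)]
  · intro d' hd'
    rw [coeff_monomial, if_neg hd', ite_self]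

/-- No monomial of `F(x^g)` lies off the image of `expSum g`. [cite: Kato1994, §3] -/
theorem coeff_substGenerators_eq_zero_of_forall_ne (F : MvPowerSeries ι R) {e : σ →₀ ℕ} (he : ∀ d, expSum g d ≠ e) :
    coeff e (substGenerators (R := R) g hg0 F) = 0 := by
  classical
  rw [substGenerators_apply, coeff_subst_monomial g hg0]
  exact finsum_eq_zero_of_forall_eq_zero fun d => if_neg (he d)

/-- **Support transport**: a monomial `e` of `F(x^g)` comes from a monomial `d` of `F` with `expSum g d = e`. [cite: Kato1994, §3] -/
theorem exists_expSum_eq_of_coeff_substGenerators_ne_zero (F : MvPowerSeries ι R) {e : σ →₀ ℕ}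
    (he : coeff e (substGenerators (R := R) g hg0 F) ≠ 0) : ∃ d : ι →₀ ℕ, expSum g d = e ∧ coeff d F ≠ 0 := by
  classical
  by_contra h
  push Not at h
  apply he
  rw [substGenerators_apply, coeff_subst_monomial g hg0]
  refine finsum_eq_zero_of_forall_eq_zero fun d => ?_
  split_ifs with hd
  · exact h d hd
  · rfl

omit [Finite ι] in
/-- `expSum` coordinatewise: `(expSum g d) s = Σ_{i ∈ supp d} d i * g i s`. [cite: Kato1994, §3] -/
theorem expSum_apply (d : ι →₀ ℕ) (s : σ) : expSum g d s = d.sum fun i n => n * g i s := by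
  unfold expSum
  rw [Finsupp.sum_apply]
  simp only [Finsupp.smul_apply, smul_eq_mul]

omit [Finite ι] in
/-- **Even ↦ even**: if every exponent of `d` is divisible by `p`, so is every exponent of `expSum g d`. [folklore] -/
theorem dvd_expSum_apply (p : ℕ) {d : ι →₀ ℕ} (hd : ∀ i, p ∣ d i) (s : σ) : p ∣ expSum g d s := by
  rw [expSum_apply]
  exact Finset.dvd_sum fun i _ => Dvd.dvd.mul_right (hd i) _

/-- A series supported on `pℕ^ι` substitutes to a series supported on `pℕ^σ`. [folklore] -/
theorem isSupportedOnMultiples_substGenerators (p : ℕ) {F : MvPowerSeries ι R} (hF : IsSupportedOnMultiples p F) :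
    IsSupportedOnMultiples p (substGenerators (R := R) g hg0 F) := by
  rintro e ⟨s, hs⟩
  by_contra hne
  obtain ⟨d, hde, hd⟩ := exists_expSum_eq_of_coeff_substGenerators_ne_zero g hg0 F hne
  have hdiv : ∀ i, p ∣ d i := by
    intro i
    by_contra hi
    exact hd (hF d ⟨i, hi⟩)
  exact hs (hde ▸ dvd_expSum_apply g p hdiv s)

end General

section Injective

variable (hinj : Function.Injective (expSum g))
include hinj

/-- **Exact coefficient transport along an injective exponent map**: `coeff_{expSum g d} (F(x^g)) = coeff_d F` — the expansion of
`F(x^g)` is the relabelled expansion of `F` (tri-2 audit §2(i)). [cite: Kato1994, §3] -/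
theorem coeff_substGenerators_expSum (F : MvPowerSeries ι R) (d : ι →₀ ℕ) :
    coeff (expSum g d) (substGenerators (R := R) g hg0 F) = coeff d F := by
  classical
  rw [substGenerators_apply, coeff_subst_monomial g hg0, finsum_eq_single _ d]
  · rw [if_pos rfl]
  · intro d' hd'
    rw [if_neg (fun h => hd' (hinj h))]

/-- **Injectivity of the chart map** `F ↦ F(x^g)` for an injective exponent map. [folklore] -/
theorem substGenerators_injective : Function.Injective (substGenerators (R := R) g hg0) := by
  intro F G hFG
  ext d
  rw [← coeff_substGenerators_expSum g hg0 hinj F d, ← coeff_substGenerators_expSum g hg0 hinj G d, hFG]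

omit [Finite ι] in
omit hinj in
/-- **Odd ↦ odd** under the parity-reflection hypothesis: an exponent with a coordinate not divisible by `p` maps to one.
[folklore] -/
theorem exists_not_dvd_expSum_apply (p : ℕ) (hrefl : ∀ d : ι →₀ ℕ, (∀ s, p ∣ expSum g d s) → ∀ i, p ∣ d i)
    {d : ι →₀ ℕ} (hd : ∃ i, ¬ p ∣ d i) : ∃ s, ¬ p ∣ expSum g d s := by
  by_contra h
  push Not at h
  obtain ⟨i, hi⟩ := hd
  exact hi (hrefl d h i)

/-- **Parity is transported exactly**: `F` is supported on `pℕ^ι` iff `F(x^g)` is supported on `pℕ^σ` (injective exponent map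
with parity reflection). [folklore] -/
theorem isSupportedOnMultiples_substGenerators_iff (p : ℕ)
    (hrefl : ∀ d : ι →₀ ℕ, (∀ s, p ∣ expSum g d s) → ∀ i, p ∣ d i) (F : MvPowerSeries ι R) :
    IsSupportedOnMultiples p (substGenerators (R := R) g hg0 F) ↔ IsSupportedOnMultiples p F := by
  refine ⟨fun h d hd => ?_, isSupportedOnMultiples_substGenerators g hg0 p⟩
  rw [← coeff_substGenerators_expSum g hg0 hinj F d]
  exact h _ (exists_not_dvd_expSum_apply g p hrefl hd)

end Injective

section Chart

variable {σ : Type u} [Fintype σ] [DecidableEq σ] (j : σ) (M : ℕ)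

/-! ### The chart family `x_j ↦ x_j`, `x_i ↦ x_j^M · x_i` (`i ≠ j`)
`M = 1`: the blow-up chart at the persisting letter `x_j` (`X ↦ x, Y ↦ xy, Z ↦ xz`); general `M`: the `M`-step free substitution
`ỹ ↦ x^M ỹ_M, z̃ ↦ x^M z̃_M` of Lemma F / F♭ (res-L0-w41-stub-2 PART 1 (ii)). Exponents: `g i = M • single j 1 + single i 1` off `j`,
`g j = single j 1`, written uniformly as `single i 1 + if i = j then 0 else M • single j 1`. -/

omit [Fintype σ] in
/-- The chart exponents are non-zero (the variables map to non-constant monomials). [folklore] -/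
theorem chartExp_ne_zero (i : σ) :
    (Finsupp.single i 1 + if i = j then 0 else M • Finsupp.single j 1 : σ →₀ ℕ) ≠ 0 := by
  intro h
  have := Finsupp.ext_iff.mp h i
  rw [Finsupp.add_apply, Finsupp.single_eq_same, Finsupp.coe_zero, Pi.zero_apply] at this
  omega

omit [Fintype σ] in
/-- Closed form of the chart exponent map off the persisting letter: `(expSum g d) i = d i` for `i ≠ j` (`x_i ↦ x_j^M x_i` keeps
the `x_i`-exponent). [folklore] -/
theorem expSum_chart_apply_of_ne (d : σ →₀ ℕ) {i : σ} (hi : i ≠ j) :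
    expSum (fun i : σ => Finsupp.single i 1 + if i = j then 0 else M • Finsupp.single j 1) d i = d i := by
  classical
  rw [expSum_apply]
  have hterm : ∀ i', (d i' * (Finsupp.single i' 1 + if i' = j then 0 else M • Finsupp.single j 1 : σ →₀ ℕ) i) =
      if i' = i then d i else 0 := by
    intro i'
    have h0 : (if i' = j then 0 else M • Finsupp.single j 1 : σ →₀ ℕ) i = 0 := by
      split_ifs
      · rfl
      · rw [Finsupp.smul_apply, Finsupp.single_eq_of_ne hi, smul_zero]
    rw [Finsupp.add_apply, h0, add_zero]
    by_cases h2 : i' = i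
    · subst h2; rw [Finsupp.single_eq_same, mul_one, if_pos rfl]
    · rw [Finsupp.single_eq_of_ne (Ne.symm h2), mul_zero, if_neg h2]
  unfold Finsupp.sum
  simp_rw [hterm]
  rw [Finset.sum_ite_eq' d.support i]
  split_ifs with hmem
  · rfl
  · exact (Finsupp.notMem_support_iff.mp hmem).symm

/-- Closed form at the persisting letter: `(expSum g d) j = d j + M · Σ_{i ≠ j} d i`. [folklore] -/
theorem expSum_chart_apply_self (d : σ →₀ ℕ) :
    expSum (fun i : σ => Finsupp.single i 1 + if i = j then 0 else M • Finsupp.single j 1) d j =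
      d j + M * ∑ i ∈ Finset.univ.erase j, d i := by
  classical
  rw [expSum_apply]
  have hterm : ∀ i', (d i' * (Finsupp.single i' 1 + if i' = j then 0 else M • Finsupp.single j 1 : σ →₀ ℕ) j) =
      if i' = j then d j else M * d i' := by
    intro i'
    rw [Finsupp.add_apply]
    split_ifs with h1
    · subst h1; rw [Finsupp.single_eq_same, Finsupp.coe_zero, Pi.zero_apply, add_zero, mul_one]
    · rw [Finsupp.single_eq_of_ne (Ne.symm h1), zero_add, Finsupp.smul_apply, Finsupp.single_eq_same, smul_eq_mul, mul_one,
        mul_comm]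
  unfold Finsupp.sum
  simp_rw [hterm]
  rw [Finset.sum_subset (Finset.subset_univ d.support) (fun i _ hi => by
    have h0 : d i = 0 := Finsupp.notMem_support_iff.mp hi
    split_ifs with h
    · rw [← h, h0]
    · rw [h0, mul_zero]), ← Finset.add_sum_erase _ _ (Finset.mem_univ j), if_pos rfl,
    Finset.mul_sum]
  congr 1
  exact Finset.sum_congr rfl fun x hx => if_neg (Finset.ne_of_mem_erase hx)

/-- **The chart exponent map is injective** (triangular: `d i = e i` off `j`, `d j = e j − M Σ_{i ≠ j} e i`); this is tri-2's audit
§2(i) «`x^a ỹ^b z̃^γ ↦ x^{a+m(b+|γ|)} ỹ_m^b z̃_m^γ` is injective on exponents». [folklore] -/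
theorem expSum_chart_injective :
    Function.Injective (expSum (fun i : σ => Finsupp.single i 1 + if i = j then 0 else M • Finsupp.single j 1)) := by
  intro d d' h
  have hne : ∀ i, i ≠ j → d i = d' i := fun i hi => by
    rw [← expSum_chart_apply_of_ne j M d hi, ← expSum_chart_apply_of_ne j M d' hi, h]
  have hj := congrArg (fun e : σ →₀ ℕ => e j) h
  simp only [expSum_chart_apply_self] at hj
  have hrest : ∑ x ∈ Finset.univ.erase j, d x = ∑ x ∈ Finset.univ.erase j, d' x :=
    Finset.sum_congr rfl fun x hx => hne x (Finset.ne_of_mem_erase hx)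
  rw [hrest] at hj
  ext i
  by_cases hi : i = j
  · subst hi; omega
  · exact hne i hi

/-- **Parity reflection for the chart**: if every exponent of `expSum g d` is divisible by `p`, so is every exponent of `d`
(odd monomials map to odd monomials «both ways», tri-2's audit §1 (γ) / §2(i)). [folklore] -/
theorem dvd_of_dvd_expSum_chart (p : ℕ) (d : σ →₀ ℕ)
    (h : ∀ s, p ∣ expSum (fun i : σ => Finsupp.single i 1 + if i = j then 0 else M • Finsupp.single j 1) d s) (i : σ) :
    p ∣ d i := by
  have hne : ∀ i, i ≠ j → p ∣ d i := fun i hi => by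
    have := h i
    rwa [expSum_chart_apply_of_ne j M d hi] at this
  by_cases hi : i = j
  · subst hi
    have hj := h i
    rw [expSum_chart_apply_self] at hj
    have hrest : p ∣ M * ∑ x ∈ Finset.univ.erase i, d x :=
      Dvd.dvd.mul_left (Finset.dvd_sum fun x hx => hne x (Finset.ne_of_mem_erase hx)) _
    exact (Nat.dvd_add_left hrest).mp hj
  · exact hne i hi

/-- **Realisability on exponents**: `e` lies in the monoid `⟨g⟩` of the chart iff `M · Σ_{i ≠ j} e i ≤ e j` (for `M = 1`:
«`x^a y^b z^γ ∈ K⟦x, xy, xz⟧ ⟺ b + |γ| ≤ a`», NT-DIRECT (α)). [folklore] -/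
theorem mem_closure_chart_iff (e : σ →₀ ℕ) :
    e ∈ AddSubmonoid.closure
        (Set.range fun i : σ => (Finsupp.single i 1 + if i = j then 0 else M • Finsupp.single j 1 : σ →₀ ℕ)) ↔
      M * ∑ i ∈ Finset.univ.erase j, e i ≤ e j := by
  constructor
  · intro he
    induction he using AddSubmonoid.closure_induction with
    | mem x hx =>
      obtain ⟨i, rfl⟩ := hx
      dsimp only
      by_cases hij : i = j
      · subst hij
        rw [if_pos rfl, add_zero, Finsupp.single_eq_same,
          Finset.sum_eq_zero (fun x hx => Finsupp.single_eq_of_ne (Finset.ne_of_mem_erase hx)), mul_zero]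
        exact Nat.zero_le _
      · rw [if_neg hij, Finsupp.add_apply, Finsupp.single_eq_of_ne (Ne.symm hij), zero_add, Finsupp.smul_apply,
          Finsupp.single_eq_same, smul_eq_mul, mul_one]
        have hsum : ∑ x ∈ Finset.univ.erase j, (Finsupp.single i 1 + M • Finsupp.single j 1 : σ →₀ ℕ) x = 1 := by
          rw [Finset.sum_eq_single_of_mem i (Finset.mem_erase.mpr ⟨hij, Finset.mem_univ i⟩)]
          · rw [Finsupp.add_apply, Finsupp.single_eq_same, Finsupp.smul_apply, Finsupp.single_eq_of_ne hij, smul_zero, add_zero]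
          · intro x hx hxi
            rw [Finsupp.add_apply, Finsupp.single_eq_of_ne hxi, Finsupp.smul_apply,
              Finsupp.single_eq_of_ne (Finset.ne_of_mem_erase hx), smul_zero, add_zero]
        rw [hsum, mul_one]
    | zero => simp
    | add x y _ _ hx hy =>
      simp only [Finsupp.add_apply, Finset.sum_add_distrib, mul_add]
      exact Nat.add_le_add hx hy
  · intro he
    -- the preimage exponent: `e` with the `j`-coordinate lowered to `e j − M Σ_{i ≠ j} e i`
    set d : σ →₀ ℕ := e.update j (e j - M * ∑ i ∈ Finset.univ.erase j, e i) with hd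
    have hde : expSum (fun i : σ => Finsupp.single i 1 + if i = j then 0 else M • Finsupp.single j 1) d = e := by
      have hrest : ∑ x ∈ Finset.univ.erase j, d x = ∑ x ∈ Finset.univ.erase j, e x :=
        Finset.sum_congr rfl fun x hx => by rw [hd, Finsupp.update_apply, if_neg (Finset.ne_of_mem_erase hx)]
      ext i
      by_cases hi : i = j
      · subst hi
        rw [expSum_chart_apply_self, hrest, hd, Finsupp.update_apply, if_pos rfl]
        omega
      · rw [expSum_chart_apply_of_ne j M d hi, hd, Finsupp.update_apply, if_neg hi]
    rw [← hde]
    exact expSum_mem_closure _ d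

/-- Realisability on supports: `F(x^g)` has no monomial `e` with `e j < M · Σ_{i ≠ j} e i`. [folklore] -/
theorem coeff_substGenerators_chart_eq_zero (F : MvPowerSeries σ R) {e : σ →₀ ℕ}
    (he : e j < M * ∑ i ∈ Finset.univ.erase j, e i) :
    coeff e (substGenerators (R := R) (fun i : σ => Finsupp.single i 1 + if i = j then 0 else M • Finsupp.single j 1)
      (chartExp_ne_zero j M) F) = 0 := by
  refine coeff_substGenerators_eq_zero_of_forall_ne _ _ F fun d hd => ?_
  have := (mem_closure_chart_iff j M e).mp (hd ▸ expSum_mem_closure _ d)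
  omega

/-- **The law read on supports** (NT-DIRECT (α) at `M = 1`: `x^d · f₁ = (f₀ − g₀²)(x, xy, xz) ⇒ b + |γ| ≤ a + d` for every
monomial `x^a y^b z^γ` of `f₁`; Lemma F at general `M`: `f₀ = Ψ_M² + x^{Md} f_M`): if `x_j^n · f = F(x^g)` then every monomial `e`
of `f` has `M · Σ_{i ≠ j} e i ≤ e j + n`. [folklore] -/
theorem mul_sum_le_add_of_X_pow_mul_eq_substGenerators {n : ℕ} {f F : MvPowerSeries σ R}
    (h : X j ^ n * f = substGenerators (R := R) (fun i : σ => Finsupp.single i 1 + if i = j then 0 else M • Finsupp.single j 1)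
      (chartExp_ne_zero j M) F)
    {e : σ →₀ ℕ} (he : coeff e f ≠ 0) : M * ∑ i ∈ Finset.univ.erase j, e i ≤ e j + n := by
  have hcoeff : coeff (e + Finsupp.single j n) (X j ^ n * f) = coeff e f := by
    rw [X_pow_eq, coeff_monomial_mul, if_pos le_add_self, add_tsub_cancel_right, one_mul]
  by_contra hlt
  push Not at hlt
  apply he
  rw [← hcoeff, h]
  refine coeff_substGenerators_chart_eq_zero j M F ?_
  rw [Finsupp.add_apply, Finsupp.single_eq_same]
  have hrest : ∑ x ∈ Finset.univ.erase j, (e + Finsupp.single j n) x = ∑ x ∈ Finset.univ.erase j, e x :=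
    Finset.sum_congr rfl fun x hx => by
      rw [Finsupp.add_apply, Finsupp.single_eq_of_ne (Finset.ne_of_mem_erase hx), add_zero]
  rw [hrest]
  omega

/-- **Exact coefficient transport for the chart** (the tree's `substGenerators` at the chart exponents is injective on monomials):
`coeff_{expSum g d} (F(x^g)) = coeff_d F`, and `F ↦ F(x^g)` is injective. [folklore] -/
theorem coeff_substGenerators_chart_expSum (F : MvPowerSeries σ R) (d : σ →₀ ℕ) :
    coeff (expSum (fun i : σ => Finsupp.single i 1 + if i = j then 0 else M • Finsupp.single j 1) d)
      (substGenerators (R := R) (fun i : σ => Finsupp.single i 1 + if i = j then 0 else M • Finsupp.single j 1)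
        (chartExp_ne_zero j M) F) = coeff d F :=
  coeff_substGenerators_expSum _ _ (expSum_chart_injective j M) F d

/-- The three-variable free chart of Lemma F♭ in closed form: with the persisting letter `0` and weight `M`,
`expSum g e = e + single 0 (M·(e 1 + e 2))` = res-L0-w41-stub-2's `freeShift M e` («`x^a ỹ^b z̃^c ↦ x^{a+M(b+c)} ỹ_M^b z̃_M^c`»), so
`coeff_substGenerators_chart_expSum` discharges the coefficientwise reading hypothesis of `G3Perf.free_support`. [folklore] -/
theorem expSum_chart_fin_three (M : ℕ) (e : Fin 3 →₀ ℕ) :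
    expSum (fun i : Fin 3 => Finsupp.single i 1 + if i = 0 then 0 else M • Finsupp.single 0 1) e =
      e + Finsupp.single 0 (M * (e 1 + e 2)) := by
  ext i
  by_cases hi : i = 0
  · subst hi
    rw [expSum_chart_apply_self, Finsupp.add_apply, Finsupp.single_eq_same]
    have h12 : (Finset.univ : Finset (Fin 3)).erase 0 = {1, 2} := by decide
    rw [h12, Finset.sum_pair (by decide)]
  · rw [expSum_chart_apply_of_ne 0 M e hi, Finsupp.add_apply, Finsupp.single_eq_of_ne hi, add_zero]

end Chart

end Summit.ResolutionOfSingularities.ResolutionOfSingularities.Theorems.SwitchingDichotomy.ChartMonomialSubst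

end
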